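import Literature.Geometry.Symplectic.CircleInvariantForms
import Literature.Geometry.Symplectic.McleanDivisorComplementConvexFourGluing
import Mathlib.MeasureTheory.Integral.IntervalIntegral.FundThmCalculus
import HarnessLib

/-!
# The integral of `dh(X)` over an orbit of a circle action vanishes

Topic `Literature/Geometry/Symplectic`; a small lemma of the fact seat of
`Literature.Geometry.Symplectic.mclean_divisorComplement_convex_four` (M. McLean, GAFA 22
(2012), Lemma 5.17), identifying the locally constant `κ` of the tube normal form
(`McleanTubeNormalForm.lean`: `κ = θ(X) - r²/2 - dh(X)`) with the intrinsic wrapping number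
`(2π)⁻¹ ∮θ - r²/2` of p. 36: since `t ↦ h(e^{it} y)` is `2π`-periodic,

  `∫₀^{2π} dh_{e^{it}y}(X(e^{it}y)) dt = h(y) - h(y) = 0`
  (`integral_mextDeriv_ofFun_circleOrbit`),

for a smooth circle action (`[MulAction Circle N]`, `X = circleFundVec`) and `h` of class `C^∞`.
The derivative of the orbit function is `d/dt h(e^{it} y) = dh(X)(e^{it} y)`
(`hasDerivAt_comp_circleOrbit`; chain rule with `mfderiv_circleOrbit_apply_one`).

Everything is proved; no definitions, no named facts (D-0026).

## References

* M. McLean, *The growth rate of symplectic homology and affine varieties*, Geom. Funct. Anal. 22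
  (2012), p. 36 (the wrapping number). [Mclean2012]
-/

noncomputable section

open scoped Manifold ContDiff Topology Real
open Set Function Filter MeasureTheory intervalIntegral
open Literature.Geometry.Kaehler Literature.Geometry.Manifold

namespace Literature.Geometry.Symplectic

variable {m : ℕ} {N : Type*} [TopologicalSpace N] [ChartedSpace (EuclideanSpace ℝ (Fin m)) N]
  [IsManifold (𝓡 m) ∞ N] [MulAction Circle N]

/-- **The derivative of a function along an orbit is `dh(X)`**: for a smooth circle action and
`h` of class `C^∞`, the real function `t ↦ h(e^{it} y)` has derivative
`d h_{e^{it}y}(X(e^{it}y))` (written with the tree's `d` of a `0`-form, a real number).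
[folklore] -/
theorem hasDerivAt_comp_circleOrbit
    (hθ : ContMDiff ((𝓡 1).prod (𝓡 m)) (𝓡 m) ∞ (fun x : Circle × N => x.1 • x.2))
    {h : N → ℝ} (hh : ContMDiff (𝓡 m) 𝓘(ℝ, ℝ) ∞ h) (y : N) (t : ℝ) :
    HasDerivAt (fun t : ℝ ↦ h (Circle.exp t • y))
      (mextDeriv (MForm.ofFun (𝓡 m) h) (Circle.exp t • y)
        ![circleFundVec (Circle.exp t • y)]) t := by
  set c : ℝ → N := fun t ↦ Circle.exp t • y with hc
  have hcs : ContMDiff 𝓘(ℝ, ℝ) (𝓡 m) ∞ c :=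
    contMDiff_circleOrbit (θ := fun (a : Circle) (x : N) => a • x) hθ y
  have hg : ContMDiff 𝓘(ℝ, ℝ) 𝓘(ℝ, ℝ) ∞ (h ∘ c) := hh.comp hcs
  have hg' : ContDiff ℝ ∞ (h ∘ c) := contMDiff_iff_contDiff.1 hg
  -- the abstract derivative of the smooth real function `h ∘ c`
  have hD : HasDerivAt (h ∘ c) (deriv (h ∘ c) t) t :=
    ((hg'.differentiable (by simp)) t).hasDerivAt
  -- identify it in the `mfderiv` world
  have hmd : MDifferentiableAt (𝓡 m) 𝓘(ℝ, ℝ) h (c t) := (hh _).mdifferentiableAt (by simp)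
  have hcomp : HasMFDerivAt 𝓘(ℝ, ℝ) 𝓘(ℝ, ℝ) (h ∘ c) t
      ((mfderiv (𝓡 m) 𝓘(ℝ, ℝ) h (c t)).comp (mfderiv 𝓘(ℝ, ℝ) (𝓡 m) c t)) :=
    hmd.hasMFDerivAt.comp t ((hcs t).mdifferentiableAt (by simp)).hasMFDerivAt
  have h1 : deriv (h ∘ c) t = mfderiv 𝓘(ℝ, ℝ) 𝓘(ℝ, ℝ) (h ∘ c) t (1 : ℝ) := by
    rw [mfderiv_eq_fderiv]
    rfl
  have h2 : @id ℝ (mfderiv 𝓘(ℝ, ℝ) 𝓘(ℝ, ℝ) (h ∘ c) t (1 : ℝ)) =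
      @id ℝ (mfderiv (𝓡 m) 𝓘(ℝ, ℝ) h (c t) (circleFundVec (c t))) := by
    rw [hcomp.mfderiv, ← mfderiv_circleOrbit_apply_one hθ y t]
    rfl
  have h3 : mextDeriv (MForm.ofFun (𝓡 m) h) (c t) ![circleFundVec (c t)] =
      @id ℝ (mfderiv (𝓡 m) 𝓘(ℝ, ℝ) h (c t) (circleFundVec (c t))) := by
    rw [mextDeriv_ofFun_apply_eq_mfderiv hmd]
    rfl
  have h4 : deriv (h ∘ c) t =
      mextDeriv (MForm.ofFun (𝓡 m) h) (c t) ![circleFundVec (c t)] := by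
    rw [h3, ← h2, h1]
    rfl
  rw [← h4]
  exact hD

/-- **The integral of `dh(X)` over an orbit vanishes**: `∫₀^{2π} dh_{e^{it}y}(X(e^{it}y)) dt = 0`
(fundamental theorem of calculus for the `2π`-periodic function `t ↦ h(e^{it} y)`).  With the
tube normal form `κ = θ(X) - r²/2 - dh(X)` (constant along orbits, as is `r²`) this identifies
`2πκ = ∮_{S¹·y} θ - π r²`, McLean's wrapping number (p. 36).
[cite: Mclean2012, Lemma 5.17 (proof)] -/
theorem integral_mextDeriv_ofFun_circleOrbit
    (hθ : ContMDiff ((𝓡 1).prod (𝓡 m)) (𝓡 m) ∞ (fun x : Circle × N => x.1 • x.2))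
    {h : N → ℝ} (hh : ContMDiff (𝓡 m) 𝓘(ℝ, ℝ) ∞ h) (y : N) :
    ∫ t in (0 : ℝ)..2 * π, mextDeriv (MForm.ofFun (𝓡 m) h) (Circle.exp t • y)
      ![circleFundVec (Circle.exp t • y)] = 0 := by
  have hD := fun t ↦ hasDerivAt_comp_circleOrbit hθ hh y t
  -- continuity of the integrand: it is the derivative of a `C^∞` real function
  have hcs : ContMDiff 𝓘(ℝ, ℝ) (𝓡 m) ∞ (fun t : ℝ ↦ Circle.exp t • y) :=
    contMDiff_circleOrbit (θ := fun (a : Circle) (x : N) => a • x) hθ y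
  have hg' : ContDiff ℝ ∞ (fun t : ℝ ↦ h (Circle.exp t • y)) :=
    contMDiff_iff_contDiff.1 (hh.comp hcs)
  have hderiv : deriv (fun t : ℝ ↦ h (Circle.exp t • y)) = fun t ↦
      mextDeriv (MForm.ofFun (𝓡 m) h) (Circle.exp t • y) ![circleFundVec (Circle.exp t • y)] :=
    funext fun t ↦ (hD t).deriv
  have hcont : Continuous fun t : ℝ ↦
      mextDeriv (MForm.ofFun (𝓡 m) h) (Circle.exp t • y) ![circleFundVec (Circle.exp t • y)] := by
    rw [← hderiv]
    exact hg'.continuous_deriv (by simp)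
  rw [integral_eq_sub_of_hasDerivAt (fun t _ ↦ hD t) (hcont.intervalIntegrable _ _)]
  simp

end Literature.Geometry.Symplectic
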